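import Mathlib
import Summits.QuantumFields.YangMills.Theorems.BalabanUVNodesN15ExpLetters
import HarnessLib

/-!
# Route «BalabanUVNodes» (cluster K4 «SpineRates»), Track-A DAG node N15 = spine estimate NE2, BACKGROUND LAYER — FIRST MISSING
# ESTIMATE, part 13b: THE MATRIX COEFFICIENT SPECIES `Phi1 η Z = η⁻¹(e^{ηZ} − 1)` ((3.50), the transporter) and
# `Phi2 η Z = η⁻²(e^{ηZ} − 1 − ηZ)` (`F′_{1,k}`, (3.51)–(3.52)) on a complete real normed algebra, their 12c-SHAPED letters in OPERATOR NORM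
# (`K = e`, `K′ = e·r²`; `K = e·r`, `K′ = e·r³`, regime `η₀r ≤ 1`), and the fits of the print's coefficients `Φ(η, ad_{A(b)})`

Cell `pub-ymgap`, seat `pub-ymgap-dag-n15-b` (generation g3; FIRST-MISSING-ESTIMATE, HUMAN RULING D-0062; chair R424 venue; ROSTER-D0062
l.26).  `bears_on: R4∕N15`.  Filed `--supports stmt-QuantumFields-19351`.  Second of three parts of residue (i) of `HOME/HANDOFF-dag-n15-b.md`
§g2.3 (13a `BalabanUVNodesN15ExpLetters`: the `exp`∕`ad` letters; 13c `BalabanUVNodesN15MatrixCoefficient`: the lineage's matrix-coefficient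
multiplication operators).  This is the 𝔤-VALUED version of 12c `BalabanUVNodesN15NonlinearCoefficient` (real scalar models `phi1`, `phi2`):
same statements with `|·|` replaced by the norm of a complete real normed algebra `𝔸` (for the print: `𝔸 = (𝔤 →L[ℝ] 𝔤)`, `Z = ad_{A(b)}`).

WHY.  [Balaban1985BackgroundPropagators] (3.50)–(3.52) p. 400 (verbatim, first-hand; cross-read in 12c): (3.50) *«η^{−2}(2dλ(x) −
Σ_{b∈st(x)} exp(iη ad_{A′(b)}) R(U_b)λ(b₊))»*, (3.51) *«where F′_{1,k}(z) = η^{−2}(e^{ηz} − 1 − ηz) …, hence F′_{1,k}(i ad_{A′(b)}) is an analytic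
function of A(b)»*, (3.52) *«… + Σ_{b∈st(x)} F′_{1,k}(i ad_{A′(b)}) λ(b₊)»*.  Under the η-pairing the fine coefficient is `Φ(η′, ad_{A′(b′)})`,
the coarse one `Φ(η, ad_{Ā(πb′)})` (in the anti-Hermitian convention `ad_A` is a real operator and `exp(η ad_A) = Ad(e^{ηA})`; the print's `i`
is the Hermitian convention); `fit_nonlinearV` (12c's `fit_nonlinear` for normed groups) turns the two letters `K`, `K′` and the field's fit
`‖A′(b′) − Ā(πb′)‖ ≤ o` into the coefficient fit `K·o + 2K′·η` — both of rate one; the regime `η‖ad A‖ ≤ 2η‖A‖ ≤ 1` is the print's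
smallness of `O(1)Mα₀` (p. 397).  THE PRINT USED (SHAPES only): (3.35) p. 396; (3.50)–(3.52) p. 400.  Nothing of [B9] asserted.

CONTENTS (all [folklore]; 13a BY NAME).
* §1 `Phi1`, `Phi2` (`Phi1 0 Z = Z`, `Phi2 0 Z = Z²∕2`), `norm_smul_le_of_regime`; the LETTERS, 12c's shape verbatim with norms:
  `Phi1_lipschitz` (`K = e`, 13a `norm_exp_sub_exp_le` at `ρ = 1`), `Phi1_consistency` (`K′ = e·r²`, 13a `norm_exp_sub_one_sub_self_le` + the tree's
  `B9Eq349ConjugatedQTowerLetterLinear.exp_sub_one_le_exp_one_mul`),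
  `norm_half_sq_sub_half_sq_le` (the `η = 0` case, no commutativity), `Phi2_lipschitz` (`K = e·r`, 13a `norm_exp_sub_exp_sub_sub_le` at `ρ = ηr`),
  `Phi2_consistency` (`K′ = e·r³`, 13a `norm_exp_sub_one_sub_sub_sq_le`).  (12c's scalar constants: `e`, `r²`, `2r`, `r³`.)
* §2 FITS: `fit_nonlinearV` (generic normed-group form of 12c's `fit_nonlinear`); instances `fit_Phi1`, `fit_Phi2` (coefficients `Φ(η, A(b))`,
  `‖A‖ ≤ r`, `η₀r ≤ 1`); `lipschitz_comp_adCLM` ∕ `consistency_comp_adCLM` (the composite `Z ↦ Φ(η, ad Z)` inherits the letters with `r ↦ 2r`,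
  `K ↦ 2K`); THE PRINT's coefficients: `fit_Phi1_ad`, `fit_Phi2_ad` (`‖A‖ ≤ r`, regime `η₀·(2r) ≤ 1`: `2e·o + 2e(2r)²η` resp.
  `2e(2r)·o + 2e(2r)³η`).

HONEST FRAMING ∕ LIMITS.  MECHANISM over hypothesis-SHAPED letters; `𝔤` modelled by any complete real normed algebra, `ad` by the commutator;
linearised transport (the field fit `o` is a LETTER, discharged by 12a∕12d∕13c); crude constants.  NE2⁺ NOT PRINTED, NOT proved; count-neutral
(typed 28∕28; nothing discharged); one finite T⁴ at fixed ε — NOT infinite volume, NOT OS on ℝ⁴, NOT a mass gap, NOT Clay.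
-/

noncomputable section

namespace Summit.QuantumFields.YangMills.BalabanUVNodes.N15.MatrixSpecies

open NormedSpace Set
open Literature.MathematicalPhysics.QuantumFieldTheory.Balaban1983to89.Beta.AveragingCorrectionJets (adCLM)
open Literature.MathematicalPhysics.QuantumFieldTheory.Balaban1983to89.B9Eq349ConjugatedQTowerLetterLinear (exp_sub_one_le_exp_one_mul)

/-! ## §1 The two printed coefficient species as maps `ℝ → 𝔸 → 𝔸`, and their letters -/

section Species

variable {𝔸 : Type*} [NormedRing 𝔸] [NormedAlgebra ℝ 𝔸] [CompleteSpace 𝔸]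

/-- THE TRANSPORTER SPECIES `Phi1 η Z = η⁻¹(e^{ηZ} − 1)` (value `Z` at `η = 0`): the print's coefficient `η⁻¹(exp(η ad_{A(b)}) − 1)` of the
covariant derivative (3.50), as a map on a normed algebra. [folklore] -/
def Phi1 (η : ℝ) (Z : 𝔸) : 𝔸 := if η = 0 then Z else η⁻¹ • (exp (η • Z) - 1)

/-- THE SECOND-ORDER SPECIES `Phi2 η Z = η⁻²(e^{ηZ} − 1 − ηZ)` (value `Z²∕2` at `η = 0`): the print's *«F′_{1,k}(z) = η^{−2}(e^{ηz} − 1 − ηz)»*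
(3.51)–(3.52), as a map on a normed algebra. [folklore] -/
def Phi2 (η : ℝ) (Z : 𝔸) : 𝔸 := if η = 0 then (2 : ℝ)⁻¹ • Z ^ 2 else (η ^ 2)⁻¹ • (exp (η • Z) - 1 - η • Z)

omit [NormedAlgebra ℝ 𝔸] [CompleteSpace 𝔸] in
/-- At zero spacing `Phi1` is the identity (the continuum coefficient `ad_A`). [folklore] -/
@[simp] theorem Phi1_zero [NormedAlgebra ℝ 𝔸] (Z : 𝔸) : Phi1 0 Z = Z := by simp [Phi1]

omit [CompleteSpace 𝔸] in
/-- At zero spacing `Phi2` is `Z²∕2`. [folklore] -/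
@[simp] theorem Phi2_zero (Z : 𝔸) : Phi2 0 Z = (2 : ℝ)⁻¹ • Z ^ 2 := by simp [Phi2]

omit [CompleteSpace 𝔸] in
/-- In the regime `η₀r ≤ 1`: `0 ≤ s ≤ η₀`, `‖Z‖ ≤ r` ⟹ `‖s • Z‖ ≤ s·r ≤ 1`. [folklore] -/
theorem norm_smul_le_of_regime {η₀ r s : ℝ} {Z : 𝔸} (hreg : η₀ * r ≤ 1) (hs0 : 0 ≤ s) (hs : s ≤ η₀) (hZ : ‖Z‖ ≤ r) :
    ‖s • Z‖ ≤ s * r ∧ s * r ≤ 1 := by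
  have hr : 0 ≤ r := (norm_nonneg Z).trans hZ
  refine ⟨?_, (mul_le_mul hs le_rfl hr (hs0.trans hs)).trans hreg⟩
  rw [norm_smul, Real.norm_eq_abs, abs_of_nonneg hs0]
  exact mul_le_mul_of_nonneg_left hZ hs0

/-- LETTER `K = e` for `Phi1`: on `0 ≤ η ≤ η₀`, `‖Z‖ ≤ r`, `η₀r ≤ 1`, `Phi1(η, ·)` is `e`-Lipschitz in operator norm (13a `norm_exp_sub_exp_le` at
`ρ = 1`). [folklore] -/
theorem Phi1_lipschitz {η₀ r : ℝ} (hreg : η₀ * r ≤ 1) :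
    ∀ s, 0 ≤ s → s ≤ η₀ → ∀ Z₁ Z₂ : 𝔸, ‖Z₁‖ ≤ r → ‖Z₂‖ ≤ r →
      ‖Phi1 s Z₁ - Phi1 s Z₂‖ ≤ Real.exp 1 * ‖Z₁ - Z₂‖ := by
  intro s hs0 hs Z₁ Z₂ hZ₁ hZ₂
  have he : (1 : ℝ) ≤ Real.exp 1 := by have := Real.add_one_le_exp (1 : ℝ); linarith
  by_cases h0 : s = 0
  · subst h0
    simp only [Phi1_zero]
    exact le_mul_of_one_le_left (norm_nonneg _) he
  · have hspos : 0 < s := lt_of_le_of_ne hs0 (Ne.symm h0)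
    have h1 := norm_smul_le_of_regime hreg hs0 hs hZ₁
    have h2 := norm_smul_le_of_regime hreg hs0 hs hZ₂
    have hrepr : Phi1 s Z₁ - Phi1 s Z₂ = s⁻¹ • (exp (s • Z₁) - exp (s • Z₂)) := by
      simp only [Phi1, if_neg h0, ← smul_sub]
      congr 1
      abel
    rw [hrepr, norm_smul, norm_inv, Real.norm_eq_abs, abs_of_pos hspos]
    have key := norm_exp_sub_exp_le (ρ := 1) (h1.1.trans h1.2) (h2.1.trans h2.2)
    rw [← smul_sub, norm_smul, Real.norm_eq_abs, abs_of_pos hspos] at key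
    calc s⁻¹ * ‖exp (s • Z₁) - exp (s • Z₂)‖ ≤ s⁻¹ * (Real.exp 1 * (s * ‖Z₁ - Z₂‖)) :=
          mul_le_mul_of_nonneg_left key (inv_nonneg.2 hs0)
      _ = Real.exp 1 * ‖Z₁ - Z₂‖ := by field_simp

/-- LETTER `K′ = e·r²` for `Phi1`: `‖Phi1(η, Z) − Z‖ = η⁻¹‖e^{ηZ} − 1 − ηZ‖ ≤ η⁻¹·‖ηZ‖(e^{‖ηZ‖} − 1) ≤ e·r²·η` (13a
`norm_exp_sub_one_sub_self_le`, `e^u − 1 ≤ eu` on `[0,1]`). [folklore] -/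
theorem Phi1_consistency {η₀ r : ℝ} (hreg : η₀ * r ≤ 1) :
    ∀ s, 0 ≤ s → s ≤ η₀ → ∀ Z : 𝔸, ‖Z‖ ≤ r → ‖Phi1 s Z - Phi1 0 Z‖ ≤ Real.exp 1 * r ^ 2 * s := by
  intro s hs0 hs Z hZ
  have hr : 0 ≤ r := (norm_nonneg Z).trans hZ
  by_cases h0 : s = 0
  · subst h0; simp
  · have hspos : 0 < s := lt_of_le_of_ne hs0 (Ne.symm h0)
    have h1 := norm_smul_le_of_regime hreg hs0 hs hZ
    have hrepr : Phi1 s Z - Phi1 0 Z = s⁻¹ • (exp (s • Z) - 1 - s • Z) := by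
      rw [Phi1_zero]
      simp only [Phi1, if_neg h0, smul_sub, smul_smul, inv_mul_cancel₀ h0, one_smul]
    rw [hrepr, norm_smul, norm_inv, Real.norm_eq_abs, abs_of_pos hspos]
    have hu0 : 0 ≤ ‖s • Z‖ := norm_nonneg _
    have key : ‖exp (s • Z) - 1 - s • Z‖ ≤ (s * r) * (Real.exp 1 * (s * r)) :=
      (norm_exp_sub_one_sub_self_le (s • Z)).trans
        (mul_le_mul h1.1 ((exp_sub_one_le_exp_one_mul hu0 (h1.1.trans h1.2)).trans
          (mul_le_mul_of_nonneg_left h1.1 (Real.exp_pos 1).le))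
          (by linarith [Real.add_one_le_exp ‖s • Z‖]) (mul_nonneg hs0 hr))
    calc s⁻¹ * ‖exp (s • Z) - 1 - s • Z‖ ≤ s⁻¹ * ((s * r) * (Real.exp 1 * (s * r))) :=
          mul_le_mul_of_nonneg_left key (inv_nonneg.2 hs0)
      _ = Real.exp 1 * r ^ 2 * s := by field_simp

omit [CompleteSpace 𝔸] in
/-- The `η = 0` case of the next letter: `‖Z₁²∕2 − Z₂²∕2‖ ≤ r·‖Z₁ − Z₂‖` for `‖Z₁‖, ‖Z₂‖ ≤ r`
(`Z₁² − Z₂² = Z₁(Z₁ − Z₂) + (Z₁ − Z₂)Z₂`, no commutativity). [folklore] -/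
theorem norm_half_sq_sub_half_sq_le {r : ℝ} {Z₁ Z₂ : 𝔸} (hZ₁ : ‖Z₁‖ ≤ r) (hZ₂ : ‖Z₂‖ ≤ r) :
    ‖(2 : ℝ)⁻¹ • Z₁ ^ 2 - (2 : ℝ)⁻¹ • Z₂ ^ 2‖ ≤ r * ‖Z₁ - Z₂‖ := by
  have key : Z₁ ^ 2 - Z₂ ^ 2 = Z₁ * (Z₁ - Z₂) + (Z₁ - Z₂) * Z₂ := by noncomm_ring
  rw [← smul_sub, key, norm_smul, norm_inv, Real.norm_two]
  have h1 : ‖Z₁ * (Z₁ - Z₂)‖ ≤ r * ‖Z₁ - Z₂‖ := (norm_mul_le _ _).trans (mul_le_mul_of_nonneg_right hZ₁ (norm_nonneg _))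
  have h2 : ‖(Z₁ - Z₂) * Z₂‖ ≤ ‖Z₁ - Z₂‖ * r := (norm_mul_le _ _).trans (mul_le_mul_of_nonneg_left hZ₂ (norm_nonneg _))
  have h3 := (norm_add_le _ _).trans (add_le_add h1 h2)
  have : (2 : ℝ)⁻¹ * ‖Z₁ * (Z₁ - Z₂) + (Z₁ - Z₂) * Z₂‖ ≤ (2 : ℝ)⁻¹ * (r * ‖Z₁ - Z₂‖ + ‖Z₁ - Z₂‖ * r) :=
    mul_le_mul_of_nonneg_left h3 (by norm_num)
  linarith [mul_comm ‖Z₁ - Z₂‖ r]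

/-- LETTER `K = e·r` for `Phi2`: on `0 ≤ η ≤ η₀`, `‖Z‖ ≤ r`, `η₀r ≤ 1`, `Phi2(η, ·)` is `(e·r)`-Lipschitz in operator norm: for `η ≠ 0`,
`Phi2 η Z₁ − Phi2 η Z₂ = η⁻²((e^{ηZ₁} − e^{ηZ₂}) − (ηZ₁ − ηZ₂))` and 13a's second-order letter at `ρ = ηr` gives `(e^{ηr} − 1) ≤ ηr·e`;
at `η = 0` `norm_half_sq_sub_half_sq_le`. [folklore] -/
theorem Phi2_lipschitz {η₀ r : ℝ} (hreg : η₀ * r ≤ 1) :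
    ∀ s, 0 ≤ s → s ≤ η₀ → ∀ Z₁ Z₂ : 𝔸, ‖Z₁‖ ≤ r → ‖Z₂‖ ≤ r →
      ‖Phi2 s Z₁ - Phi2 s Z₂‖ ≤ Real.exp 1 * r * ‖Z₁ - Z₂‖ := by
  intro s hs0 hs Z₁ Z₂ hZ₁ hZ₂
  have hr : 0 ≤ r := (norm_nonneg Z₁).trans hZ₁
  have he : (1 : ℝ) ≤ Real.exp 1 := by have := Real.add_one_le_exp (1 : ℝ); linarith
  by_cases h0 : s = 0
  · subst h0
    simp only [Phi2_zero]
    refine (norm_half_sq_sub_half_sq_le hZ₁ hZ₂).trans ?_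
    have : r * ‖Z₁ - Z₂‖ ≤ Real.exp 1 * (r * ‖Z₁ - Z₂‖) :=
      le_mul_of_one_le_left (mul_nonneg hr (norm_nonneg _)) he
    linarith [mul_assoc (Real.exp 1) r ‖Z₁ - Z₂‖]
  · have hspos : 0 < s := lt_of_le_of_ne hs0 (Ne.symm h0)
    have h1 := norm_smul_le_of_regime hreg hs0 hs hZ₁
    have h2 := norm_smul_le_of_regime hreg hs0 hs hZ₂
    have hrepr : Phi2 s Z₁ - Phi2 s Z₂ =
        (s ^ 2)⁻¹ • ((exp (s • Z₁) - exp (s • Z₂)) - (s • Z₁ - s • Z₂)) := by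
      simp only [Phi2, if_neg h0]
      module
    have hs2 : 0 < s ^ 2 := by positivity
    rw [hrepr, norm_smul, norm_inv, norm_pow, Real.norm_eq_abs, abs_of_pos hspos]
    have key := norm_exp_sub_exp_sub_sub_le (ρ := s * r) h1.1 h2.1
    have hsub : ‖s • Z₁ - s • Z₂‖ = s * ‖Z₁ - Z₂‖ := by
      rw [← smul_sub, norm_smul, Real.norm_eq_abs, abs_of_pos hspos]
    rw [hsub] at key
    have hexp : Real.exp (s * r) - 1 ≤ Real.exp 1 * (s * r) := exp_sub_one_le_exp_one_mul (mul_nonneg hs0 hr) h1.2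
    calc (s ^ 2)⁻¹ * ‖(exp (s • Z₁) - exp (s • Z₂)) - (s • Z₁ - s • Z₂)‖
        ≤ (s ^ 2)⁻¹ * ((Real.exp (s * r) - 1) * (s * ‖Z₁ - Z₂‖)) := mul_le_mul_of_nonneg_left key (inv_nonneg.2 hs2.le)
      _ ≤ (s ^ 2)⁻¹ * ((Real.exp 1 * (s * r)) * (s * ‖Z₁ - Z₂‖)) := by gcongr
      _ = Real.exp 1 * r * ‖Z₁ - Z₂‖ := by field_simp

/-- LETTER `K′ = e·r³` for `Phi2`: `‖Phi2(η, Z) − Z²∕2‖ = η⁻²‖e^{ηZ} − 1 − ηZ − (ηZ)²∕2‖ ≤ η⁻²·‖ηZ‖²(e^{‖ηZ‖} − 1) ≤ e·r³·η` (13a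
`norm_exp_sub_one_sub_sub_sq_le`). [folklore] -/
theorem Phi2_consistency {η₀ r : ℝ} (hreg : η₀ * r ≤ 1) :
    ∀ s, 0 ≤ s → s ≤ η₀ → ∀ Z : 𝔸, ‖Z‖ ≤ r → ‖Phi2 s Z - Phi2 0 Z‖ ≤ Real.exp 1 * r ^ 3 * s := by
  intro s hs0 hs Z hZ
  have hr : 0 ≤ r := (norm_nonneg Z).trans hZ
  by_cases h0 : s = 0
  · subst h0; simp
  · have hspos : 0 < s := lt_of_le_of_ne hs0 (Ne.symm h0)
    have h1 := norm_smul_le_of_regime hreg hs0 hs hZ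
    have hs2 : 0 < s ^ 2 := by positivity
    have hrepr : Phi2 s Z - Phi2 0 Z = (s ^ 2)⁻¹ • (exp (s • Z) - 1 - s • Z - (2 : ℝ)⁻¹ • (s • Z) ^ 2) := by
      rw [Phi2_zero]
      simp only [Phi2, if_neg h0, smul_pow]
      match_scalars <;> field_simp
    rw [hrepr, norm_smul, norm_inv, norm_pow, Real.norm_eq_abs, abs_of_pos hspos]
    have hu0 : 0 ≤ ‖s • Z‖ := norm_nonneg _
    have hsq : ‖s • Z‖ ^ 2 ≤ (s * r) ^ 2 := pow_le_pow_left₀ hu0 h1.1 2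
    have key : ‖exp (s • Z) - 1 - s • Z - (2 : ℝ)⁻¹ • (s • Z) ^ 2‖ ≤ (s * r) ^ 2 * (Real.exp 1 * (s * r)) :=
      (norm_exp_sub_one_sub_sub_sq_le (s • Z)).trans
        (mul_le_mul hsq ((exp_sub_one_le_exp_one_mul hu0 (h1.1.trans h1.2)).trans
          (mul_le_mul_of_nonneg_left h1.1 (Real.exp_pos 1).le))
          (by linarith [Real.add_one_le_exp ‖s • Z‖]) (sq_nonneg _))
    calc (s ^ 2)⁻¹ * ‖exp (s • Z) - 1 - s • Z - (2 : ℝ)⁻¹ • (s • Z) ^ 2‖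
        ≤ (s ^ 2)⁻¹ * ((s * r) ^ 2 * (Real.exp 1 * (s * r))) := mul_le_mul_of_nonneg_left key (inv_nonneg.2 hs2.le)
      _ = Real.exp 1 * r ^ 3 * s := by field_simp

end Species

/-! ## §2 Fits: the generic normed-group form of 12c's `fit_nonlinear`, and the four printed instances -/

section Fit

variable {X X' : Type*} {V W : Type*} [NormedAddCommGroup V] [NormedAddCommGroup W]

/-- SPECIES S1 (generic, normed-group form of 12c's `fit_nonlinear`).  A coefficient map `Φ(η, z)` with two letters on the box
`0 ≤ η ≤ η₀`, `‖z‖ ≤ r`: a `z`-LIPSCHITZ constant `K ≥ 0` and SPACING CONSISTENCY `‖Φ(η, z) − Φ(0, z)‖ ≤ K′·η`, `K′ ≥ 0`.  For a fine field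
`a′` and a coarse field `a` both of size `≤ r`, spacings `0 ≤ η′ ≤ η ≤ η₀`, and the species-S0 fit `‖a′(x′) − a(πx′)‖ ≤ o(πx′)`:
`‖Φ(η′, a′x′) − Φ(η, a(πx′))‖ ≤ K·o(πx′) + 2K′·η`. [folklore] -/
theorem fit_nonlinearV (π : X' → X) (Φ : ℝ → V → W) {η₀ r K K' η η' : ℝ} (hK : 0 ≤ K) (hK' : 0 ≤ K')
    (hLz : ∀ s, 0 ≤ s → s ≤ η₀ → ∀ z₁ z₂, ‖z₁‖ ≤ r → ‖z₂‖ ≤ r → ‖Φ s z₁ - Φ s z₂‖ ≤ K * ‖z₁ - z₂‖)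
    (hCη : ∀ s, 0 ≤ s → s ≤ η₀ → ∀ z, ‖z‖ ≤ r → ‖Φ s z - Φ 0 z‖ ≤ K' * s)
    (hη' : 0 ≤ η') (hη'η : η' ≤ η) (hη : η ≤ η₀)
    {a' : X' → V} {a : X → V} (ha' : ∀ x', ‖a' x'‖ ≤ r) (ha : ∀ x, ‖a x‖ ≤ r)
    {o : X → ℝ} (hfit : ∀ x', ‖a' x' - a (π x')‖ ≤ o (π x')) (x' : X') :
    ‖Φ η' (a' x') - Φ η (a (π x'))‖ ≤ K * o (π x') + 2 * K' * η := by
  have h1 : ‖Φ η' (a' x') - Φ η' (a (π x'))‖ ≤ K * o (π x') :=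
    (hLz η' hη' (hη'η.trans hη) _ _ (ha' x') (ha _)).trans (mul_le_mul_of_nonneg_left (hfit x') hK)
  have h2 : ‖Φ η' (a (π x')) - Φ 0 (a (π x'))‖ ≤ K' * η' := hCη η' hη' (hη'η.trans hη) _ (ha _)
  have h3 : ‖Φ 0 (a (π x')) - Φ η (a (π x'))‖ ≤ K' * η := by
    rw [norm_sub_rev]; exact hCη η (hη'.trans hη'η) hη _ (ha _)
  have hmono : K' * η' ≤ K' * η := mul_le_mul_of_nonneg_left hη'η hK'
  calc ‖Φ η' (a' x') - Φ η (a (π x'))‖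
      = ‖(Φ η' (a' x') - Φ η' (a (π x'))) + (Φ η' (a (π x')) - Φ 0 (a (π x'))) + (Φ 0 (a (π x')) - Φ η (a (π x')))‖ := by
        congr 1; abel
    _ ≤ ‖Φ η' (a' x') - Φ η' (a (π x'))‖ + ‖Φ η' (a (π x')) - Φ 0 (a (π x'))‖ + ‖Φ 0 (a (π x')) - Φ η (a (π x'))‖ :=
        norm_add₃_le
    _ ≤ K * o (π x') + K' * η' + K' * η := add_le_add (add_le_add h1 h2) h3
    _ ≤ K * o (π x') + 2 * K' * η := by linarith

variable {𝔸 : Type*} [NormedRing 𝔸] [NormedAlgebra ℝ 𝔸] [CompleteSpace 𝔸]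

/-- INSTANCE `Phi1` on `𝔸`-valued fields of size `≤ r` (`η₀r ≤ 1`): `‖Phi1(η′, a′x′) − Phi1(η, a(πx′))‖ ≤ e·o(πx′) + 2·(e·r²)·η`. [folklore] -/
theorem fit_Phi1 (π : X' → X) {η₀ r η η' : ℝ} (hreg : η₀ * r ≤ 1) (hη' : 0 ≤ η') (hη'η : η' ≤ η) (hη : η ≤ η₀)
    {a' : X' → 𝔸} {a : X → 𝔸} (ha' : ∀ x', ‖a' x'‖ ≤ r) (ha : ∀ x, ‖a x‖ ≤ r)
    {o : X → ℝ} (hfit : ∀ x', ‖a' x' - a (π x')‖ ≤ o (π x')) (x' : X') :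
    ‖Phi1 η' (a' x') - Phi1 η (a (π x'))‖ ≤ Real.exp 1 * o (π x') + 2 * (Real.exp 1 * r ^ 2) * η :=
  fit_nonlinearV π Phi1 (Real.exp_pos 1).le (by positivity) (Phi1_lipschitz hreg) (Phi1_consistency hreg)
    hη' hη'η hη ha' ha hfit x'

/-- INSTANCE `Phi2` on `𝔸`-valued fields of size `≤ r` (`η₀r ≤ 1`): `‖Phi2(η′, a′x′) − Phi2(η, a(πx′))‖ ≤ (e·r)·o(πx′) + 2·(e·r³)·η`. [folklore] -/
theorem fit_Phi2 (π : X' → X) {η₀ r η η' : ℝ} (hreg : η₀ * r ≤ 1) (hr : 0 ≤ r) (hη' : 0 ≤ η') (hη'η : η' ≤ η) (hη : η ≤ η₀)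
    {a' : X' → 𝔸} {a : X → 𝔸} (ha' : ∀ x', ‖a' x'‖ ≤ r) (ha : ∀ x, ‖a x‖ ≤ r)
    {o : X → ℝ} (hfit : ∀ x', ‖a' x' - a (π x')‖ ≤ o (π x')) (x' : X') :
    ‖Phi2 η' (a' x') - Phi2 η (a (π x'))‖ ≤ (Real.exp 1 * r) * o (π x') + 2 * (Real.exp 1 * r ^ 3) * η :=
  fit_nonlinearV π Phi2 (by positivity) (by positivity) (Phi2_lipschitz hreg) (Phi2_consistency hreg)
    hη' hη'η hη ha' ha hfit x'

variable {𝔄 : Type*} [NormedRing 𝔄] [NormedAlgebra ℝ 𝔄] [CompleteSpace 𝔄]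

omit [CompleteSpace 𝔄] in
/-- The composite species `Z ↦ Φ(η, ad Z)` inherits the letters with `r ↦ 2r` and `K ↦ 2K`: Lipschitz. [folklore] -/
theorem lipschitz_comp_adCLM (Φ : ℝ → (𝔄 →L[ℝ] 𝔄) → (𝔄 →L[ℝ] 𝔄)) {η₀ r K : ℝ} (hK : 0 ≤ K)
    (hLz : ∀ s, 0 ≤ s → s ≤ η₀ → ∀ T₁ T₂ : 𝔄 →L[ℝ] 𝔄, ‖T₁‖ ≤ 2 * r → ‖T₂‖ ≤ 2 * r → ‖Φ s T₁ - Φ s T₂‖ ≤ K * ‖T₁ - T₂‖) :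
    ∀ s, 0 ≤ s → s ≤ η₀ → ∀ Z₁ Z₂ : 𝔄, ‖Z₁‖ ≤ r → ‖Z₂‖ ≤ r →
      ‖Φ s (adCLM ℝ Z₁) - Φ s (adCLM ℝ Z₂)‖ ≤ (2 * K) * ‖Z₁ - Z₂‖ := by
  intro s hs0 hs Z₁ Z₂ hZ₁ hZ₂
  calc ‖Φ s (adCLM ℝ Z₁) - Φ s (adCLM ℝ Z₂)‖ ≤ K * ‖adCLM ℝ Z₁ - adCLM ℝ Z₂‖ :=
        hLz s hs0 hs _ _ (norm_adCLM_le_of_le hZ₁) (norm_adCLM_le_of_le hZ₂)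
    _ ≤ K * (2 * ‖Z₁ - Z₂‖) := mul_le_mul_of_nonneg_left (norm_adCLM_sub_le Z₁ Z₂) hK
    _ = (2 * K) * ‖Z₁ - Z₂‖ := by ring

omit [CompleteSpace 𝔄] in
/-- The composite species `Z ↦ Φ(η, ad Z)` inherits the letters with `r ↦ 2r`: consistency. [folklore] -/
theorem consistency_comp_adCLM (Φ : ℝ → (𝔄 →L[ℝ] 𝔄) → (𝔄 →L[ℝ] 𝔄)) {η₀ r K' : ℝ}
    (hCη : ∀ s, 0 ≤ s → s ≤ η₀ → ∀ T : 𝔄 →L[ℝ] 𝔄, ‖T‖ ≤ 2 * r → ‖Φ s T - Φ 0 T‖ ≤ K' * s) :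
    ∀ s, 0 ≤ s → s ≤ η₀ → ∀ Z : 𝔄, ‖Z‖ ≤ r → ‖Φ s (adCLM ℝ Z) - Φ 0 (adCLM ℝ Z)‖ ≤ K' * s :=
  fun s hs0 hs _ hZ => hCη s hs0 hs _ (norm_adCLM_le_of_le hZ)

/-- THE PRINT's TRANSPORTER COEFFICIENT `η⁻¹(exp(η ad_{A(b)}) − 1)`: for `𝔄`-valued fields `‖A′‖, ‖Ā‖ ≤ r` in the regime `η₀·(2r) ≤ 1`
(`‖ad A‖ ≤ 2r`), `0 ≤ η′ ≤ η ≤ η₀`, and the field fit `‖A′(x′) − Ā(πx′)‖ ≤ o(πx′)`: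
`‖Phi1(η′, ad A′(x′)) − Phi1(η, ad Ā(πx′))‖ ≤ 2e·o(πx′) + 2·(e(2r)²)·η` — 12c's `fit_phi1_blockMean` shape with operator-norm letters. [folklore] -/
theorem fit_Phi1_ad (π : X' → X) {η₀ r η η' : ℝ} (hreg : η₀ * (2 * r) ≤ 1) (hη' : 0 ≤ η') (hη'η : η' ≤ η)
    (hη : η ≤ η₀) {a' : X' → 𝔄} {a : X → 𝔄} (ha' : ∀ x', ‖a' x'‖ ≤ r) (ha : ∀ x, ‖a x‖ ≤ r)
    {o : X → ℝ} (hfit : ∀ x', ‖a' x' - a (π x')‖ ≤ o (π x')) (x' : X') :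
    ‖Phi1 η' (adCLM ℝ (a' x')) - Phi1 η (adCLM ℝ (a (π x')))‖ ≤
      (2 * Real.exp 1) * o (π x') + 2 * (Real.exp 1 * (2 * r) ^ 2) * η :=
  fit_nonlinearV π (fun s Z => Phi1 s (adCLM ℝ Z)) (by positivity) (by positivity)
    (lipschitz_comp_adCLM Phi1 (Real.exp_pos 1).le (Phi1_lipschitz hreg))
    (consistency_comp_adCLM Phi1 (Phi1_consistency hreg)) hη' hη'η hη ha' ha hfit x'

/-- THE PRINT's SECOND-ORDER COEFFICIENT `F′_{1,k}(ad_{A(b)})`: same data, regime `η₀·(2r) ≤ 1`: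
`‖Phi2(η′, ad A′(x′)) − Phi2(η, ad Ā(πx′))‖ ≤ 2(e·2r)·o(πx′) + 2·(e(2r)³)·η`. [folklore] -/
theorem fit_Phi2_ad (π : X' → X) {η₀ r η η' : ℝ} (hreg : η₀ * (2 * r) ≤ 1) (hr : 0 ≤ r) (hη' : 0 ≤ η') (hη'η : η' ≤ η)
    (hη : η ≤ η₀) {a' : X' → 𝔄} {a : X → 𝔄} (ha' : ∀ x', ‖a' x'‖ ≤ r) (ha : ∀ x, ‖a x‖ ≤ r)
    {o : X → ℝ} (hfit : ∀ x', ‖a' x' - a (π x')‖ ≤ o (π x')) (x' : X') :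
    ‖Phi2 η' (adCLM ℝ (a' x')) - Phi2 η (adCLM ℝ (a (π x')))‖ ≤
      (2 * (Real.exp 1 * (2 * r))) * o (π x') + 2 * (Real.exp 1 * (2 * r) ^ 3) * η :=
  fit_nonlinearV π (fun s Z => Phi2 s (adCLM ℝ Z)) (by positivity) (by positivity)
    (lipschitz_comp_adCLM Phi2 (by positivity) (Phi2_lipschitz hreg))
    (consistency_comp_adCLM Phi2 (Phi2_consistency hreg)) hη' hη'η hη ha' ha hfit x'

end Fit

end Summit.QuantumFields.YangMills.BalabanUVNodes.N15.MatrixSpecies
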